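import Mathlib
import Summits.Ventures.PercRepro2.TB14CutGenA
import Summits.Ventures.PercRepro2.TB14CutPendant

/-!
# Typed BHK 1.4 across a cut vertex, V: the pendant side with the roots and marks allowed AT the cut
(blind cell PercRepro2, mine-c g15, 2026-08-25; `conjectures/MINE-C.md` §24, `proofs/MINEC-TB14BLOCK.md` Theorem C)

The theorems of `TB14CutPendant` with every vertex hypothesis on the CLOSED sides `VA ∪ {c}`,
`VB ∪ {c}` — a root or a mark may be the cut vertex itself (`iL_cross'` of `TB14CutGenA`).  The
proofs are those of the landed file verbatim; `tb14_of_pendant_cut'` is the statement the block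
induction needs.  Own work; standard axioms.
-/

namespace Summit.Ventures.PercRepro2

namespace TB14Cut

open CovForm A3InactiveTyped CutV

section Main

variable {V : Type} {E : Type} [Fintype E] [DecidableEq E] {ends : E → Sym2 V} {c : V}
  {VA VB : Set V} {EA EB : Set E} [DecidablePred (· ∈ EA)] [DecidablePred (· ∈ EB)]
  {R : Type*} [Field R] [LinearOrder R] [IsStrictOrderedRing R]

/-- **Both marks on the root side**: the pendant side is a spectator,
`D = D_A(b, o) · N_B(Ω)`. -/
theorem tb14_of_pendant_none' (h : IsCut ends c VA VB EA EB) {a₁ a₂ b o : V} (ha₁ : a₁ ∈ VA ∪ {c})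
    (ha₂ : a₂ ∈ VA ∪ {c}) (hb : b ∈ VA ∪ {c}) (ho : o ∈ VA ∪ {c}) (F : Finset E) (z : Config E)
    (hA : pairCount (sideFree EA F) (restrict EA z) (sameBO ends a₁ a₂ b o : Config E → Config E → R) ≤
      pairCount (sideFree EA F) (restrict EA z) (crossBO ends a₁ a₂ b o)) :
    pairCount F z (sameBO ends a₁ a₂ b o : Config E → Config E → R) ≤
      pairCount F z (crossBO ends a₁ a₂ b o) := by
  rw [← sub_nonneg, tb14_slack_eq]
  have hQ : ∀ u : Config E, (iQ ends a₁ a₂ (restrict EA u) : R) = iQ ends a₁ a₂ u :=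
    iQ_restrict_EA h ha₁ ha₂
  have hℓ : ∀ u : Config E, (iL ends a₁ b (restrict EA u) : R) = iL ends a₁ b u :=
    iL_restrict_EA h ha₁ hb
  have hh : ∀ u : Config E, (iH ends a₂ o (restrict EA u) : R) = iH ends a₂ o u := fun u =>
    iL_restrict_EA h ha₂ ho u
  have e1 : pairCount F z (fun y w => (iQ ends a₁ a₂ y : R) * iQ ends a₁ a₂ w * iL ends a₁ b y *
      (iH ends a₂ o w - iH ends a₂ o y)) =
      pairCount F z (fun y w => (iQ ends a₁ a₂ y * iQ ends a₁ a₂ w * iL ends a₁ b y *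
        (iH ends a₂ o w - iH ends a₂ o y)) * (1 : R)) := by
    congr 1
    funext y w
    ring
  rw [e1, pairCount_mul_of_cut h F z _ _ (fun y w => by simp only [hQ, hℓ, hh]) (fun _ _ => rfl),
    ← tb14_slack_eq]
  exact mul_nonneg (sub_nonneg.2 hA) (pairCount_nonneg _ _ _ fun _ _ => zero_le_one)

/-- **`b` beyond the cut**: `D = D_A(c, o) · N_B(b ∈ C(c))`. -/
theorem tb14_of_pendant_b' (h : IsCut ends c VA VB EA EB) {a₁ a₂ b o : V} (ha₁ : a₁ ∈ VA ∪ {c})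
    (ha₂ : a₂ ∈ VA ∪ {c}) (hb : b ∈ VB ∪ {c}) (ho : o ∈ VA ∪ {c}) (F : Finset E) (z : Config E)
    (hA : pairCount (sideFree EA F) (restrict EA z) (sameBO ends a₁ a₂ c o : Config E → Config E → R) ≤
      pairCount (sideFree EA F) (restrict EA z) (crossBO ends a₁ a₂ c o)) :
    pairCount F z (sameBO ends a₁ a₂ b o : Config E → Config E → R) ≤
      pairCount F z (crossBO ends a₁ a₂ b o) := by
  rw [← sub_nonneg, tb14_slack_eq]
  have hQ : ∀ u : Config E, (iQ ends a₁ a₂ (restrict EA u) : R) = iQ ends a₁ a₂ u :=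
    iQ_restrict_EA h ha₁ ha₂
  have hs : ∀ u : Config E, (iL ends a₁ c (restrict EA u) : R) = iL ends a₁ c u :=
    iL_restrict_EA h ha₁ (Or.inr rfl)
  have hh : ∀ u : Config E, (iH ends a₂ o (restrict EA u) : R) = iH ends a₂ o u := fun u =>
    iL_restrict_EA h ha₂ ho u
  have hρ : ∀ u : Config E, (iL ends c b (restrict EB u) : R) = iL ends c b u := fun u =>
    iH_restrict_EB h (Or.inr rfl) hb u
  have hpt : ∀ y w : Config E,
      (iQ ends a₁ a₂ y : R) * iQ ends a₁ a₂ w * iL ends a₁ b y *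
          (iH ends a₂ o w - iH ends a₂ o y) =
        (iQ ends a₁ a₂ y * iQ ends a₁ a₂ w * iL ends a₁ c y *
          (iH ends a₂ o w - iH ends a₂ o y)) * iL ends c b y := by
    intro y w
    rw [iL_cross' h ha₁ hb y]
    ring
  simp_rw [hpt]
  rw [pairCount_mul_of_cut h F z _ _ (fun y w => by simp only [hQ, hs, hh])
    (fun y w => by simp only [hρ]), ← tb14_slack_eq]
  exact mul_nonneg (sub_nonneg.2 hA) (pairCount_nonneg _ _ _ fun y _ => iL_nonneg'' ends c b y)

/-- **`o` beyond the cut**: `D = D_A(b, c) · N_B(o ∈ C(c))`. -/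
theorem tb14_of_pendant_o' (h : IsCut ends c VA VB EA EB) {a₁ a₂ b o : V} (ha₁ : a₁ ∈ VA ∪ {c})
    (ha₂ : a₂ ∈ VA ∪ {c}) (hb : b ∈ VA ∪ {c}) (ho : o ∈ VB ∪ {c}) (F : Finset E) (z : Config E)
    (hA : pairCount (sideFree EA F) (restrict EA z) (sameBO ends a₁ a₂ b c : Config E → Config E → R) ≤
      pairCount (sideFree EA F) (restrict EA z) (crossBO ends a₁ a₂ b c)) :
    pairCount F z (sameBO ends a₁ a₂ b o : Config E → Config E → R) ≤
      pairCount F z (crossBO ends a₁ a₂ b o) := by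
  rw [← sub_nonneg, tb14_slack_eq]
  have hQ : ∀ u : Config E, (iQ ends a₁ a₂ (restrict EA u) : R) = iQ ends a₁ a₂ u :=
    iQ_restrict_EA h ha₁ ha₂
  have hℓ : ∀ u : Config E, (iL ends a₁ b (restrict EA u) : R) = iL ends a₁ b u :=
    iL_restrict_EA h ha₁ hb
  have ht : ∀ u : Config E, (iH ends a₂ c (restrict EA u) : R) = iH ends a₂ c u := fun u =>
    iL_restrict_EA h ha₂ (Or.inr rfl) u
  have hκ : ∀ u : Config E, (iH ends c o (restrict EB u) : R) = iH ends c o u :=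
    iH_restrict_EB h (Or.inr rfl) ho
  have hcross : ∀ u : Config E, (iH ends a₂ o u : R) = iH ends a₂ c u * iH ends c o u := fun u =>
    iL_cross' h ha₂ ho u
  have hpt : ∀ y w : Config E,
      (iQ ends a₁ a₂ y : R) * iQ ends a₁ a₂ w * iL ends a₁ b y *
          (iH ends a₂ o w - iH ends a₂ o y) =
        (iQ ends a₁ a₂ y * iQ ends a₁ a₂ w * iL ends a₁ b y * iH ends a₂ c w) * iH ends c o w -
          (iQ ends a₁ a₂ y * iQ ends a₁ a₂ w * iL ends a₁ b y * iH ends a₂ c y) * iH ends c o y := by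
    intro y w
    rw [hcross y, hcross w]
    ring
  simp_rw [hpt]
  rw [pairCount_sub,
    pairCount_mul_of_cut h F z _ _ (fun y w => by simp only [hQ, hℓ, ht])
      (fun y w => by simp only [hκ]),
    pairCount_mul_of_cut h F z _ _ (fun y w => by simp only [hQ, hℓ, ht])
      (fun y w => by simp only [hκ])]
  have hN : pairCount (sideFree EB F) (restrict EB z) (fun _ w => (iH ends c o w : R)) =
      pairCount (sideFree EB F) (restrict EB z) (fun y _ => iH ends c o y) :=
    pairCount_swap _ _ _
  rw [hN, ← sub_mul, ← pairCount_sub]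
  have hD : pairCount (sideFree EA F) (restrict EA z)
      (fun y w => (iQ ends a₁ a₂ y : R) * iQ ends a₁ a₂ w * iL ends a₁ b y * iH ends a₂ c w -
        iQ ends a₁ a₂ y * iQ ends a₁ a₂ w * iL ends a₁ b y * iH ends a₂ c y) =
      pairCount (sideFree EA F) (restrict EA z) (crossBO ends a₁ a₂ b c : Config E → Config E → R) -
        pairCount (sideFree EA F) (restrict EA z) (sameBO ends a₁ a₂ b c) := by
    rw [tb14_slack_eq]
    congr 1
    funext y w
    ring
  rw [hD]
  exact mul_nonneg (sub_nonneg.2 hA) (pairCount_nonneg _ _ _ fun y _ => iL_nonneg'' ends c o y)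

/-- **Both marks beyond the cut**: `D = N_A(Q, c ∈ C(a₁), c ∈ C'(a₂)) · N_B(b ∈ C(c), o ∈ C'(c))`,
a product of two nonnegative counts — typed BHK 1.4 holds unconditionally. -/
theorem tb14_of_pendant_both' (h : IsCut ends c VA VB EA EB) {a₁ a₂ b o : V} (ha₁ : a₁ ∈ VA ∪ {c})
    (ha₂ : a₂ ∈ VA ∪ {c}) (hb : b ∈ VB ∪ {c}) (ho : o ∈ VB ∪ {c}) (F : Finset E) (z : Config E) :
    pairCount F z (sameBO ends a₁ a₂ b o : Config E → Config E → R) ≤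
      pairCount F z (crossBO ends a₁ a₂ b o) := by
  rw [← sub_nonneg, tb14_slack_eq]
  have hQ : ∀ u : Config E, (iQ ends a₁ a₂ (restrict EA u) : R) = iQ ends a₁ a₂ u :=
    iQ_restrict_EA h ha₁ ha₂
  have hs : ∀ u : Config E, (iL ends a₁ c (restrict EA u) : R) = iL ends a₁ c u :=
    iL_restrict_EA h ha₁ (Or.inr rfl)
  have ht : ∀ u : Config E, (iH ends a₂ c (restrict EA u) : R) = iH ends a₂ c u := fun u =>
    iL_restrict_EA h ha₂ (Or.inr rfl) u
  have hρ : ∀ u : Config E, (iL ends c b (restrict EB u) : R) = iL ends c b u := fun u =>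
    iH_restrict_EB h (Or.inr rfl) hb u
  have hκ : ∀ u : Config E, (iH ends c o (restrict EB u) : R) = iH ends c o u :=
    iH_restrict_EB h (Or.inr rfl) ho
  have hcross : ∀ u : Config E, (iH ends a₂ o u : R) = iH ends a₂ c u * iH ends c o u := fun u =>
    iL_cross' h ha₂ ho u
  have hpt : ∀ y w : Config E,
      (iQ ends a₁ a₂ y : R) * iQ ends a₁ a₂ w * iL ends a₁ b y *
          (iH ends a₂ o w - iH ends a₂ o y) =
        (iQ ends a₁ a₂ y * iQ ends a₁ a₂ w * iL ends a₁ c y * iH ends a₂ c w) *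
          (iL ends c b y * iH ends c o w) := by
    intro y w
    rw [hcross y, hcross w, iL_cross' h ha₁ hb y]
    have h0 := iQ_mul_both_eq_zero (R := R) ends a₁ a₂ c y
    linear_combination (-(iQ ends a₁ a₂ w * iL ends c b y * iH ends c o y)) * h0
  simp_rw [hpt]
  rw [pairCount_mul_of_cut h F z _ _ (fun y w => by simp only [hQ, hs, ht])
    (fun y w => by simp only [hρ, hκ])]
  refine mul_nonneg (pairCount_nonneg _ _ _ fun y w => ?_) (pairCount_nonneg _ _ _ fun y w => ?_)
  · exact mul_nonneg (mul_nonneg (mul_nonneg (iQ_nonneg ends a₁ a₂ y) (iQ_nonneg ends a₁ a₂ w))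
      (iL_nonneg'' ends a₁ c y)) (iL_nonneg'' ends a₂ c w)
  · exact mul_nonneg (iL_nonneg'' ends c b y) (iL_nonneg'' ends c o w)

/-- **Typed BHK 1.4 across a cut vertex with a pendant side, all placements of the marks**: if both
roots lie on the side `A` of an unmarked cut vertex `c`, typed BHK 1.4 at the profile `(F, z)`
follows from typed BHK 1.4 on the side `A` with roots `(a₁, a₂)` and the marks `(b, o)`, `(c, o)`,
`(b, c)` (whichever is needed). -/
theorem tb14_of_pendant_cut' (h : IsCut ends c VA VB EA EB) {a₁ a₂ b o : V} (ha₁ : a₁ ∈ VA ∪ {c})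
    (ha₂ : a₂ ∈ VA ∪ {c}) (hb : b ∈ VA ∪ {c} ∨ b ∈ VB ∪ {c}) (ho : o ∈ VA ∪ {c} ∨ o ∈ VB ∪ {c}) (F : Finset E) (z : Config E)
    (hbo : pairCount (sideFree EA F) (restrict EA z) (sameBO ends a₁ a₂ b o : Config E → Config E → R) ≤
      pairCount (sideFree EA F) (restrict EA z) (crossBO ends a₁ a₂ b o))
    (hco : pairCount (sideFree EA F) (restrict EA z) (sameBO ends a₁ a₂ c o : Config E → Config E → R) ≤
      pairCount (sideFree EA F) (restrict EA z) (crossBO ends a₁ a₂ c o))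
    (hbc : pairCount (sideFree EA F) (restrict EA z) (sameBO ends a₁ a₂ b c : Config E → Config E → R) ≤
      pairCount (sideFree EA F) (restrict EA z) (crossBO ends a₁ a₂ b c)) :
    pairCount F z (sameBO ends a₁ a₂ b o : Config E → Config E → R) ≤
      pairCount F z (crossBO ends a₁ a₂ b o) := by
  rcases hb with hb | hb <;> rcases ho with ho | ho
  · exact tb14_of_pendant_none' h ha₁ ha₂ hb ho F z hbo
  · exact tb14_of_pendant_o' h ha₁ ha₂ hb ho F z hbc
  · exact tb14_of_pendant_b' h ha₁ ha₂ hb ho F z hco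
  · exact tb14_of_pendant_both' h ha₁ ha₂ hb ho F z

end Main

end TB14Cut

end Summit.Ventures.PercRepro2
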